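import Mathlib
import Summits.RiemannHypothesis.RiemannHypothesis.Theorems.WeilFarCoercivityFloor
import HarnessLib

/-!
# Explicit lower bounds of the far-coercivity floor from the test functions `cosh(κx)·1_{[−a,a]}` (every `κ > 0`)

Helper file (`--supports stmt-RiemannHypothesis-0098`, lead-track anchor: Weil-positivity window ladder, format-C far bound),
RH-free, pure proofs.  Seat rh-explicit-weil-1 gen9 (memo `run/shared/lean/pub/rh-explicit/rh-explicit-weil-1/FORMAT-K3.md` §10.10).
Companion of `WeilFarFloorCoshTest` (the case `κ = ½`, where the quotient collapses onto `ψ` and `M`).  For every `κ > 0` the window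
function `χ = cosh(κ·)·1_{[−a,a]}` has the closed-form self-overlap
`∫ χ(x − ℓ)χ(x) dx = (sinh(κ(2a − ℓ))/κ + (2a − ℓ)cosh(κℓ))/2` (`0 ≤ ℓ ≤ 2a`, `integral_coshKappa_shift_mul`), `∫χ² = a + sinh(2κa)/(2κ)`, hence
`Q_a(χ) = Σ_{0<n≤⌊e^{2a}⌋} (Λ(n)/√n)(sinh(κ(2a − log n))/κ + (2a − log n)cosh(κ log n))` (`primeShiftForm_coshKappaTest`) and the FAMILY of
explicit kernel lower bounds `Q_a(χ)/(a + sinh(2κa)/(2κ)) ≤ λ_max(a)` (`coshKappaQuotient_le_farCoercivityFloor`).  At `κ = pntKappa a` (the PNT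
eigenfunction of C-XIII) this is the «Refinement 2» quotient `R(a)` of the seat's floor record (`λ_max − R = +0.024, +0.018, +0.017, +0.015` at
`a = 2, 2.25, 2.5, 2.75`; `R − (L − 2γ_E)` = the zeros' oscillation), now a finite prime sum certified as a lower bound of the floor for every
window and every `κ`.  Standard axioms only.
-/

set_option linter.dupNamespace false
set_option autoImplicit false

noncomputable section

open MeasureTheory Set Finset intervalIntegral
open scoped Real BigOperators ArithmeticFunction.vonMangoldt

namespace Summit.RiemannHypothesis.RiemannHypothesis.Theorems.WeilFormatC

namespace FloorCoshKappa

variable {a κ : ℝ}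

/-- `cosh(κ(x−ℓ))·cosh(κx) = (cosh(κ(2x − ℓ)) + cosh(κℓ))/2`. -/
theorem cosh_mul_cosh (κ x ℓ : ℝ) :
    Real.cosh (κ * (x - ℓ)) * Real.cosh (κ * x) = (Real.cosh (κ * (2 * x - ℓ)) + Real.cosh (κ * ℓ)) / 2 := by
  have h1 : Real.cosh (κ * (2 * x - ℓ)) = Real.cosh (κ * x + κ * (x - ℓ)) := by ring_nf
  have h2 : Real.cosh (κ * ℓ) = Real.cosh (κ * x - κ * (x - ℓ)) := by ring_nf
  rw [h1, h2, Real.cosh_add, Real.cosh_sub]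
  ring

/-- The shifted self-overlap of `χ = cosh(κ·)·1_{[−a,a]}`:
`∫ χ(x − ℓ)χ(x) dx = (sinh(κ(2a − ℓ))/κ + (2a − ℓ)·cosh(κℓ))/2` for `κ > 0`, `0 ≤ ℓ ≤ 2a`. -/
theorem integral_coshKappa_shift_mul (hκ : 0 < κ) {ℓ : ℝ} (hℓ0 : 0 ≤ ℓ) (hℓ : ℓ ≤ 2 * a) :
    ∫ x, (Icc (-a) a).indicator (fun y ↦ Real.cosh (κ * y)) (x - ℓ) * (Icc (-a) a).indicator (fun y ↦ Real.cosh (κ * y)) x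
      = (Real.sinh (κ * (2 * a - ℓ)) / κ + (2 * a - ℓ) * Real.cosh (κ * ℓ)) / 2 := by
  set I := Icc (-a) a with hI
  set g : ℝ → ℝ := fun x ↦ (Real.cosh (κ * (2 * x - ℓ)) + Real.cosh (κ * ℓ)) / 2 with hg
  have hprod : (fun x ↦ I.indicator (fun y ↦ Real.cosh (κ * y)) (x - ℓ) * I.indicator (fun y ↦ Real.cosh (κ * y)) x)
      = (Icc (ℓ - a) a).indicator g := by
    ext x
    by_cases hx : x ∈ Icc (ℓ - a) a
    · have h1 : x ∈ I := ⟨by linarith [hx.1], hx.2⟩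
      have h2 : x - ℓ ∈ I := ⟨by linarith [hx.1], by linarith [hx.2]⟩
      rw [indicator_of_mem hx, indicator_of_mem h1, indicator_of_mem h2, hg]
      exact cosh_mul_cosh κ x ℓ
    · rw [indicator_of_notMem hx]
      by_cases h1 : x ∈ I
      · have h2 : x - ℓ ∉ I := fun h2 ↦ hx ⟨by linarith [h2.1], h1.2⟩
        rw [indicator_of_notMem h2, zero_mul]
      · rw [indicator_of_notMem h1, mul_zero]
  rw [hprod, MeasureTheory.integral_indicator measurableSet_Icc, integral_Icc_eq_integral_Ioc,
    ← intervalIntegral.integral_of_le (by linarith : ℓ - a ≤ a)]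
  have hκ0 : κ ≠ 0 := hκ.ne'
  have hderiv : ∀ x ∈ uIcc (ℓ - a) a,
      HasDerivAt (fun x ↦ (Real.sinh (κ * (2 * x - ℓ)) / (2 * κ) + x * Real.cosh (κ * ℓ)) / 2) (g x) x := by
    intro x _
    have h1 : HasDerivAt (fun x ↦ Real.sinh (κ * (2 * x - ℓ))) (Real.cosh (κ * (2 * x - ℓ)) * (κ * 2)) x := by
      have hin : HasDerivAt (fun x : ℝ ↦ κ * (2 * x - ℓ)) (κ * 2) x := by
        have := ((hasDerivAt_id x).const_mul 2).sub_const ℓ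
        simpa using this.const_mul κ
      exact (Real.hasDerivAt_sinh _).comp x hin
    have h2 : HasDerivAt (fun x ↦ x * Real.cosh (κ * ℓ)) (Real.cosh (κ * ℓ)) x := by
      simpa using (hasDerivAt_id x).mul_const (Real.cosh (κ * ℓ))
    have := ((h1.div_const (2 * κ)).add h2).div_const 2
    refine this.congr_deriv ?_
    simp only [hg]
    field_simp
  have hcont : Continuous g := by simp only [hg]; fun_prop
  rw [integral_eq_sub_of_hasDerivAt hderiv (hcont.intervalIntegrable _ _)]
  have hs : Real.sinh (κ * (2 * (ℓ - a) - ℓ)) = -Real.sinh (κ * (2 * a - ℓ)) := by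
    rw [← Real.sinh_neg]; ring_nf
  rw [hs]
  field_simp
  ring

/-- `∫ χ² = a + sinh(2κa)/(2κ)` (`κ > 0`, `a ≥ 0`). -/
theorem integral_coshKappa_sq (hκ : 0 < κ) (ha : 0 ≤ a) :
    ∫ x, (Icc (-a) a).indicator (fun y ↦ Real.cosh (κ * y)) x ^ 2 = a + Real.sinh (2 * κ * a) / (2 * κ) := by
  have h := integral_coshKappa_shift_mul (a := a) hκ le_rfl (by linarith)
  simp only [sub_zero, mul_zero, Real.cosh_zero, mul_one] at h
  rw [show (fun x ↦ (Icc (-a) a).indicator (fun y ↦ Real.cosh (κ * y)) x ^ 2)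
      = fun x ↦ (Icc (-a) a).indicator (fun y ↦ Real.cosh (κ * y)) x
        * (Icc (-a) a).indicator (fun y ↦ Real.cosh (κ * y)) x from funext fun x ↦ pow_two _, h]
  have hκ0 : κ ≠ 0 := hκ.ne'
  field_simp
  ring

/-- The test function is admissible: measurable, bounded by `cosh(κa)`, vanishing off `[−a, a]`. -/
theorem coshKappaTest_admissible (a κ : ℝ) :
    Measurable ((Icc (-a) a).indicator (fun y ↦ Real.cosh (κ * y)))
      ∧ (∀ x, |(Icc (-a) a).indicator (fun y ↦ Real.cosh (κ * y)) x| ≤ Real.cosh (κ * a))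
      ∧ (∀ x, x ∉ Icc (-a) a → (Icc (-a) a).indicator (fun y ↦ Real.cosh (κ * y)) x = 0) := by
  refine ⟨(Real.continuous_cosh.measurable.comp (measurable_const.mul measurable_id)).indicator measurableSet_Icc,
    fun x ↦ ?_, fun x hx ↦ indicator_of_notMem hx _⟩
  by_cases hx : x ∈ Icc (-a) a
  · rw [indicator_of_mem hx, abs_of_pos (Real.cosh_pos _), Real.cosh_le_cosh, abs_mul, abs_mul]
    exact mul_le_mul_of_nonneg_left ((abs_le.2 ⟨hx.1, hx.2⟩).trans (le_abs_self a)) (abs_nonneg κ)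
  · rw [indicator_of_notMem hx, abs_zero]; exact (Real.cosh_pos _).le

/-- **The Rayleigh numerator of `cosh(κ·)·1_{[−a,a]}` in closed form** (`κ > 0`):
`Q_a(χ) = Σ_{0 < n ≤ ⌊e^{2a}⌋} (Λ(n)/√n)·(sinh(κ(2a − log n))/κ + (2a − log n)·cosh(κ log n))`. -/
theorem primeShiftForm_coshKappaTest (hκ : 0 < κ) (a : ℝ) :
    primeShiftForm a ((Icc (-a) a).indicator (fun y ↦ Real.cosh (κ * y)))
      = ∑ n ∈ Finset.Ioc 0 ⌊Real.exp (2 * a)⌋₊, ((Λ n : ℝ) / Real.sqrt n) *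
          (Real.sinh (κ * (2 * a - Real.log n)) / κ + (2 * a - Real.log n) * Real.cosh (κ * Real.log n)) := by
  obtain ⟨-, -, hsupp⟩ := coshKappaTest_admissible a κ
  set X := ⌊Real.exp (2 * a)⌋₊ with hX
  have hN : Real.exp (2 * a) ≤ ((X + 1 : ℕ) : ℝ) := by
    rw [hX]; push_cast; exact (Nat.lt_floor_add_one _).le
  rw [primeShiftForm_eq_sum_range hN hsupp]
  have hsub : Finset.Ioc 0 X ⊆ Finset.range (X + 1) := fun n hn ↦ by
    rw [Finset.mem_Ioc] at hn; rw [Finset.mem_range]; omega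
  rw [← Finset.sum_subset hsub fun n hn hn' ↦ by
    have h0 : n = 0 := by rw [Finset.mem_range] at hn; rw [Finset.mem_Ioc] at hn'; omega
    subst h0; simp]
  refine Finset.sum_congr rfl fun n hn ↦ ?_
  rw [Finset.mem_Ioc] at hn
  have hn1 : 1 ≤ n := hn.1
  have hn0 : (0 : ℝ) < n := by exact_mod_cast hn1
  have hlog0 : 0 ≤ Real.log n := Real.log_nonneg (by exact_mod_cast hn1)
  have hlog : Real.log n ≤ 2 * a := by
    rw [Real.log_le_iff_le_exp hn0]
    exact (Nat.cast_le.2 hn.2).trans (Nat.floor_le (Real.exp_pos _).le)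
  rw [integral_coshKappa_shift_mul hκ hlog0 hlog]
  ring

/-- `Q_a(χ) ≥ 0` for `κ > 0` (every summand is nonnegative on `log n ≤ 2a`). -/
theorem primeShiftForm_coshKappaTest_nonneg (hκ : 0 < κ) (a : ℝ) :
    0 ≤ primeShiftForm a ((Icc (-a) a).indicator (fun y ↦ Real.cosh (κ * y))) := by
  rw [primeShiftForm_coshKappaTest hκ]
  refine Finset.sum_nonneg fun n hn ↦ ?_
  rw [Finset.mem_Ioc] at hn
  have hn0 : (0 : ℝ) < n := by exact_mod_cast hn.1
  have hlog : Real.log n ≤ 2 * a := by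
    rw [Real.log_le_iff_le_exp hn0]
    exact (Nat.cast_le.2 hn.2).trans (Nat.floor_le (Real.exp_pos _).le)
  have h1 : 0 ≤ Real.sinh (κ * (2 * a - Real.log n)) := Real.sinh_nonneg_iff.2 (mul_nonneg hκ.le (by linarith))
  exact mul_nonneg (div_nonneg ArithmeticFunction.vonMangoldt_nonneg (Real.sqrt_nonneg _))
    (add_nonneg (div_nonneg h1 hκ.le) (mul_nonneg (by linarith) (Real.cosh_pos _).le))

/-- **A family of explicit lower bounds of the floor**: for every `a > 0` and `κ > 0`,
`Σ_{0<n≤⌊e^{2a}⌋} (Λ(n)/√n)(sinh(κ(2a − log n))/κ + (2a − log n)cosh(κ log n)) / (a + sinh(2κa)/(2κ)) ≤ λ_max(a)`.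
(At `κ = pntKappa a` this is the PNT-eigenfunction quotient `R(a)` of the floor record; at `κ = ½` the quotient of `WeilFarFloorCoshTest`.) -/
theorem coshKappaQuotient_le_farCoercivityFloor (ha : 0 < a) (hκ : 0 < κ) :
    (∑ n ∈ Finset.Ioc 0 ⌊Real.exp (2 * a)⌋₊, ((Λ n : ℝ) / Real.sqrt n) *
        (Real.sinh (κ * (2 * a - Real.log n)) / κ + (2 * a - Real.log n) * Real.cosh (κ * Real.log n)))
      / (a + Real.sinh (2 * κ * a) / (2 * κ)) ≤ farCoercivityFloor a := by
  obtain ⟨hm, hb, hs⟩ := coshKappaTest_admissible a κ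
  have hnorm := integral_coshKappa_sq hκ ha.le
  have hpos : 0 < ∫ x, (Icc (-a) a).indicator (fun y ↦ Real.cosh (κ * y)) x ^ 2 := by
    rw [hnorm]
    have : 0 < Real.sinh (2 * κ * a) := Real.sinh_pos_iff.2 (by positivity)
    positivity
  have h := le_csSup (primeShiftQuotients_bddAbove a) ⟨_, Real.cosh (κ * a), hm, hb, hs, hpos, rfl⟩
  rwa [primeShiftForm_coshKappaTest hκ, hnorm] at h

end FloorCoshKappa

end Summit.RiemannHypothesis.RiemannHypothesis.Theorems.WeilFormatC
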